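import Summits.Ventures.HodgeRepro2.T5SU11JacobiPhaseTailRate
import Summits.Ventures.HodgeRepro2.T5SU11SphericalXiLog

/-!
# The tail of the phase at `λ = 1` (Harish-Chandra's `Ξ`): the order `x e^{−(k−1)x}` with explicit constants

At the pole `λ = 1` of the `c`-function the large-deviation rate of `T5SU11JacobiPhaseTailRate` degenerates:
the logarithmic estimate `(1/8)(1 + t)e^{−t} ≤ Ξ(a_t) ≤ 8(1 + t)e^{−t}` (`T5SU11SphericalXiLog`) read in the
phase variable (`s ≤ t(s) ≤ s + log 2`) gives

  **`(1/16)(1 + s) e^{−s} ≤ Φ_1(s) ≤ 8 (1 + log 2 + s) e^{−s}`**   (`sphPhase_one_ge`, `sphPhase_one_le`),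

hence, for `k > 1` and `x ≥ 0`, with `r = k − 1`, the two-sided bound

  **`(1/16) e^{−rx} ((1 + x)/r + 1/r²) ≤ ∫_x^∞ e^{−(k−2)s} Φ_1(s) ds ≤ 8 e^{−rx} ((1 + log 2 + x)/r + 1/r²)`**

(`tail_xi_ge`, `tail_xi_le`; `∫_x^∞ (c + s) e^{−rs} ds = e^{−rx}((c + x)/r + 1/r²)`, `integral_affine_mul_exp_Ioi`):
the tail of the phase under `m_k Ξ dν` is of exact order `x e^{−(k−1)x}` — the rate `k − 1`, the midpoint
of the rates `k − 2 + λ` (`λ < 1`) and `k − λ` (`λ > 1`), with the polynomial factor of the pole. On the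
group the same bounds hold for `P_{k,1}(log|a| > x) · m̂_k(1)/(2π)` (`T5SU11JacobiPhaseTailGroup`), and at
the owner's weight `k = 3` the rate is `2` (`tail_xi_three_le`, `tail_xi_three_ge`). Nothing is claimed
about (N).

Blind lane: Mathlib + the HodgeRepro2 prefix only; no sorry; axioms ⊆ {propext, Classical.choice,
Quot.sound}.
-/

namespace Summit.Ventures.HodgeRepro2.T5SU11JacobiPhaseTailXi

open MeasureTheory MeasureTheory.Measure Metric Set Filter Topology
open T5SU11Unimodular T5SU11Fibration T5SU11Cartan T5SU11OneParameter T5SU11CartanProjection T5HaarCircle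
  T5BergmanCoefficient T5SU11FibrationHaar T5SU11SphericalFunction T5SU11SphericalSymmetry
  T5SU11SphericalBounds T5SU11SphericalContinuous T5SU11JacobiIwasawa T5SU11JacobiTransform
  T5SU11JacobiWeight T5SU11KFiniteMajorantPow T5SU11PhaseLaw T5SU11PhaseLawLintegral
  T5SU11JacobiLaplacePhase T5SU11PhaseTail T5SU11JacobiPhaseTailGroup T5SU11JacobiPhaseMomentsAsymptotic
  T5SU11JacobiPhaseTailRate T5SU11SphericalXiLog
open scoped Real

/-! ### The affine-exponential integrals -/

/-- `∫_0^∞ v e^{−rv} dv = 1/r²` for `r > 0`. -/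
theorem integral_mul_exp_neg_Ioi {r : ℝ} (hr : 0 < r) :
    ∫ v in Ioi (0 : ℝ), v * Real.exp (-(r * v)) = 1 / r ^ 2 := by
  have h := integral_pow_mul_exp_neg_mul_Ioi 1 hr
  simp only [pow_one, Nat.factorial_one, Nat.cast_one] at h
  exact h

/-- `∫_0^∞ e^{−rv} dv = 1/r` for `r > 0`. -/
theorem integral_exp_neg_mul_Ioi {r : ℝ} (hr : 0 < r) :
    ∫ v in Ioi (0 : ℝ), Real.exp (-(r * v)) = 1 / r := by
  have h := integral_pow_mul_exp_neg_mul_Ioi 0 hr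
  simp only [pow_zero, one_mul, Nat.factorial_zero, Nat.cast_one, zero_add, pow_one] at h
  exact h

/-- `v e^{−rv}` is integrable on `(0, ∞)` for `r > 0`. -/
theorem integrableOn_mul_exp_neg_Ioi {r : ℝ} (hr : 0 < r) :
    IntegrableOn (fun v : ℝ => v * Real.exp (-(r * v))) (Ioi 0) := by
  have h := integrableOn_pow_mul_exp_neg 1 (k := r + 2) (by linarith)
  refine h.congr_fun (fun v _ => ?_) measurableSet_Ioi
  show v ^ 1 * Real.exp (-((r + 2) * v)) * Real.exp (2 * v) = v * Real.exp (-(r * v))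
  rw [pow_one, mul_assoc, ← Real.exp_add]
  congr 2
  ring

/-- `e^{−rv}` is integrable on `(0, ∞)` for `r > 0` (in the `−(r v)` spelling). -/
theorem integrableOn_exp_neg_mul_Ioi' {r : ℝ} (hr : 0 < r) :
    IntegrableOn (fun v : ℝ => Real.exp (-(r * v))) (Ioi 0) := by
  refine (integrableOn_exp_mul_Ioi (by linarith : -r < 0) 0).congr_fun (fun v _ => ?_) measurableSet_Ioi
  simp only
  rw [neg_mul]

/-- `(c + s) e^{−rs}` is integrable on `(x, ∞)` for `r > 0`. -/
theorem integrableOn_affine_mul_exp_Ioi {r : ℝ} (hr : 0 < r) (c x : ℝ) :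
    IntegrableOn (fun s : ℝ => (c + s) * Real.exp (-(r * s))) (Ioi x) := by
  have e : ∀ s : ℝ, (c + s) * Real.exp (-(r * s)) = c * Real.exp (-r * s) + s * Real.exp (-(r * s)) :=
    fun s => by rw [neg_mul]; ring
  simp_rw [e]
  refine ((integrableOn_exp_mul_Ioi (by linarith : -r < 0) x).const_mul c).add ?_
  rcases le_or_gt 0 x with hx | hx
  · exact (integrableOn_mul_exp_neg_Ioi hr).mono_set (Ioi_subset_Ioi hx)
  · -- `(x, ∞) = (x, 0] ∪ (0, ∞)`: a bounded continuous piece and the tail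
    have h1 : IntegrableOn (fun v : ℝ => v * Real.exp (-(r * v))) (Ioc x 0) :=
      (continuous_id.mul (Real.continuous_exp.comp (continuous_const.mul continuous_id).neg)).continuousOn
        |>.integrableOn_Icc.mono_set Ioc_subset_Icc_self
    have h2 := (integrableOn_mul_exp_neg_Ioi hr)
    have : Ioi x = Ioc x 0 ∪ Ioi 0 := by
      ext v
      simp only [mem_Ioi, mem_union, mem_Ioc]
      constructor
      · intro hv
        by_cases h0 : v ≤ 0
        · exact Or.inl ⟨hv, h0⟩
        · exact Or.inr (not_le.mp h0)
      · rintro (⟨hv, _⟩ | hv)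
        · exact hv
        · linarith
    rw [this]
    exact h1.union h2

/-- **`∫_x^∞ (c + s) e^{−rs} ds = e^{−rx} ((c + x)/r + 1/r²)`** for `r > 0`. -/
theorem integral_affine_mul_exp_Ioi {r : ℝ} (hr : 0 < r) (c x : ℝ) :
    ∫ s in Ioi x, (c + s) * Real.exp (-(r * s)) = Real.exp (-(r * x)) * ((c + x) / r + 1 / r ^ 2) := by
  rw [tail_shift (fun s => (c + s) * Real.exp (-(r * s))) x]
  have e : ∀ v : ℝ, (c + (v + x)) * Real.exp (-(r * (v + x)))
      = Real.exp (-(r * x)) * ((c + x) * Real.exp (-(r * v)) + v * Real.exp (-(r * v))) := fun v => by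
    rw [show -(r * (v + x)) = -(r * v) + -(r * x) by ring, Real.exp_add]
    ring
  simp_rw [e]
  rw [integral_const_mul, integral_add ((integrableOn_exp_neg_mul_Ioi' hr).const_mul _)
    (integrableOn_mul_exp_neg_Ioi hr), integral_const_mul, integral_exp_neg_mul_Ioi hr,
    integral_mul_exp_neg_Ioi hr]
  ring

section measure

variable [MeasurableSpace Circle] [BorelSpace Circle]

/-! ### The logarithmic estimate in the phase variable -/

/-- **`Φ_1(s) ≤ 8 (1 + log 2 + s) e^{−s}`** for `s ≥ 0`. -/
theorem sphPhase_one_le {s : ℝ} (hs : 0 ≤ s) :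
    sphPhase 1 s ≤ 8 * (1 + Real.log 2 + s) * Real.exp (-s) := by
  unfold sphPhase
  have ht0 : 0 ≤ cartanOfPhase s := cartanOfPhase_nonneg s
  have ht1 : s ≤ cartanOfPhase s := le_cartanOfPhase hs
  have ht2 : cartanOfPhase s ≤ s + Real.log 2 := cartanOfPhase_le hs
  calc sph 1 (hyp (cartanOfPhase s)) ≤ 8 * (1 + cartanOfPhase s) * Real.exp (-cartanOfPhase s) :=
        sph_one_hyp_le ht0
    _ ≤ 8 * (1 + Real.log 2 + s) * Real.exp (-s) := by
        have he : Real.exp (-cartanOfPhase s) ≤ Real.exp (-s) := Real.exp_le_exp.mpr (by linarith)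
        have hl : (0 : ℝ) ≤ Real.log 2 := Real.log_nonneg (by norm_num)
        have h8 : (0 : ℝ) ≤ 8 * (1 + cartanOfPhase s) := by positivity
        calc 8 * (1 + cartanOfPhase s) * Real.exp (-cartanOfPhase s)
            ≤ 8 * (1 + cartanOfPhase s) * Real.exp (-s) := mul_le_mul_of_nonneg_left he h8
          _ ≤ 8 * (1 + Real.log 2 + s) * Real.exp (-s) := by
              apply mul_le_mul_of_nonneg_right _ (Real.exp_pos _).le
              linarith

/-- **`(1/16)(1 + s) e^{−s} ≤ Φ_1(s)`** for `s ≥ 0`. -/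
theorem sphPhase_one_ge {s : ℝ} (hs : 0 ≤ s) :
    1 / 16 * (1 + s) * Real.exp (-s) ≤ sphPhase 1 s := by
  unfold sphPhase
  have ht0 : 0 ≤ cartanOfPhase s := cartanOfPhase_nonneg s
  have ht1 : s ≤ cartanOfPhase s := le_cartanOfPhase hs
  have ht2 : cartanOfPhase s ≤ s + Real.log 2 := cartanOfPhase_le hs
  refine le_trans ?_ (le_sph_one_hyp ht0)
  have he : Real.exp (-(s + Real.log 2)) ≤ Real.exp (-cartanOfPhase s) := Real.exp_le_exp.mpr (by linarith)
  have he2 : Real.exp (-(s + Real.log 2)) = Real.exp (-s) / 2 := by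
    rw [neg_add, Real.exp_add, Real.exp_neg (Real.log 2), Real.exp_log two_pos, div_eq_mul_inv]
  calc 1 / 16 * (1 + s) * Real.exp (-s) = 1 / 8 * (1 + s) * (Real.exp (-s) / 2) := by ring
    _ = 1 / 8 * (1 + s) * Real.exp (-(s + Real.log 2)) := by rw [he2]
    _ ≤ 1 / 8 * (1 + s) * Real.exp (-cartanOfPhase s) :=
        mul_le_mul_of_nonneg_left he (by positivity)
    _ ≤ 1 / 8 * (1 + cartanOfPhase s) * Real.exp (-cartanOfPhase s) := by
        apply mul_le_mul_of_nonneg_right _ (Real.exp_pos _).le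
        linarith

/-! ### The tail at `λ = 1` -/

/-- The integrand `e^{−(k−2)s} Φ_1(s)` is integrable on `(x, ∞)` for `k > 1`, `x ≥ 0`. -/
theorem integrableOn_tail_xi {k x : ℝ} (hk : 1 < k) (hx : 0 ≤ x) :
    IntegrableOn (fun s : ℝ => Real.exp (-((k - 2) * s)) * sphPhase 1 s) (Ioi x) :=
  (integrableOn_exp_mul_sphPhase hk (by linarith) (by linarith)).mono_set (Ioi_subset_Ioi hx)

/-- **The upper bound**: for `k > 1`, `x ≥ 0`,
`∫_x^∞ e^{−(k−2)s} Φ_1(s) ds ≤ 8 e^{−(k−1)x} ((1 + log 2 + x)/(k − 1) + 1/(k − 1)²)`. -/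
theorem tail_xi_le {k x : ℝ} (hk : 1 < k) (hx : 0 ≤ x) :
    ∫ s in Ioi x, Real.exp (-((k - 2) * s)) * sphPhase 1 s
      ≤ 8 * (Real.exp (-((k - 1) * x)) * ((1 + Real.log 2 + x) / (k - 1) + 1 / (k - 1) ^ 2)) := by
  have hr : 0 < k - 1 := by linarith
  rw [← integral_affine_mul_exp_Ioi hr (1 + Real.log 2) x, ← integral_const_mul]
  refine setIntegral_mono_on (integrableOn_tail_xi hk hx)
    ((integrableOn_affine_mul_exp_Ioi hr (1 + Real.log 2) x).const_mul 8) measurableSet_Ioi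
    fun s hs => ?_
  rw [mem_Ioi] at hs
  have hs0 : 0 ≤ s := by linarith
  calc Real.exp (-((k - 2) * s)) * sphPhase 1 s
      ≤ Real.exp (-((k - 2) * s)) * (8 * (1 + Real.log 2 + s) * Real.exp (-s)) :=
        mul_le_mul_of_nonneg_left (sphPhase_one_le hs0) (Real.exp_pos _).le
    _ = 8 * ((1 + Real.log 2 + s) * (Real.exp (-((k - 2) * s)) * Real.exp (-s))) := by ring
    _ = 8 * ((1 + Real.log 2 + s) * Real.exp (-((k - 1) * s))) := by
        rw [← Real.exp_add]
        congr 3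
        ring

/-- **The lower bound**: for `k > 1`, `x ≥ 0`,
`(1/16) e^{−(k−1)x} ((1 + x)/(k − 1) + 1/(k − 1)²) ≤ ∫_x^∞ e^{−(k−2)s} Φ_1(s) ds`. -/
theorem tail_xi_ge {k x : ℝ} (hk : 1 < k) (hx : 0 ≤ x) :
    1 / 16 * (Real.exp (-((k - 1) * x)) * ((1 + x) / (k - 1) + 1 / (k - 1) ^ 2))
      ≤ ∫ s in Ioi x, Real.exp (-((k - 2) * s)) * sphPhase 1 s := by
  have hr : 0 < k - 1 := by linarith
  rw [← integral_affine_mul_exp_Ioi hr 1 x, ← integral_const_mul]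
  refine setIntegral_mono_on ((integrableOn_affine_mul_exp_Ioi hr 1 x).const_mul (1 / 16))
    (integrableOn_tail_xi hk hx) measurableSet_Ioi fun s hs => ?_
  rw [mem_Ioi] at hs
  have hs0 : 0 ≤ s := by linarith
  calc 1 / 16 * ((1 + s) * Real.exp (-((k - 1) * s)))
      = Real.exp (-((k - 2) * s)) * (1 / 16 * (1 + s) * Real.exp (-s)) := by
        rw [show -((k - 1) * s) = -((k - 2) * s) + -s by ring, Real.exp_add]
        ring
    _ ≤ Real.exp (-((k - 2) * s)) * sphPhase 1 s :=
        mul_le_mul_of_nonneg_left (sphPhase_one_ge hs0) (Real.exp_pos _).le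

/-- At the owner's weight `k = 3`: `∫_x^∞ e^{−s} Φ_1(s) ds ≤ 8 e^{−2x} ((1 + log 2 + x)/2 + 1/4)`. -/
theorem tail_xi_three_le {x : ℝ} (hx : 0 ≤ x) :
    ∫ s in Ioi x, Real.exp (-s) * sphPhase 1 s
      ≤ 8 * (Real.exp (-(2 * x)) * ((1 + Real.log 2 + x) / 2 + 1 / 4)) := by
  have h := tail_xi_le (k := 3) (by norm_num) hx
  have e : ∀ s : ℝ, Real.exp (-((3 - 2) * s)) = Real.exp (-s) := fun s => by norm_num
  simp_rw [e] at h
  norm_num at h ⊢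
  exact h

/-- At the owner's weight `k = 3`: `(1/16) e^{−2x} ((1 + x)/2 + 1/4) ≤ ∫_x^∞ e^{−s} Φ_1(s) ds`. -/
theorem tail_xi_three_ge {x : ℝ} (hx : 0 ≤ x) :
    1 / 16 * (Real.exp (-(2 * x)) * ((1 + x) / 2 + 1 / 4)) ≤ ∫ s in Ioi x, Real.exp (-s) * sphPhase 1 s := by
  have h := tail_xi_ge (k := 3) (by norm_num) hx
  have e : ∀ s : ℝ, Real.exp (-((3 - 2) * s)) = Real.exp (-s) := fun s => by norm_num
  simp_rw [e] at h
  norm_num at h ⊢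
  exact h

end measure

end Summit.Ventures.HodgeRepro2.T5SU11JacobiPhaseTailXi
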